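import Summits.ABC.ABC.Theorems.Target.Negative.NoLinearGoodScales
import HarnessLib

/-!
# Crux `Target` (stmt-ABC-2159, route ABC/FeketeScales) — NEGATIVE LEMMA, quantitative form:
# every large scale carries a triple of excess `≥ log R / 600`

Sharpening of `NoLinearGoodScales.exists_triple_linear_excess` (sibling, p106779) with the modulus
`2^{k+2}` chosen as large as the scale allows (`2^k ≤ log_9 R < 2^{k+1}`): for all large `R` there is an
abc triple with `rad(abc) ≤ R` and `c > R log R / 600`, i.e. `G(R) > R log R/600` at EVERY scale
(`exists_triple_log_excess`).  For conjunct 2 of the crux (`SparseGoodScales`): a `δ`-good scale `R`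
(`G(R) ≤ R^{1+δ}`) must have `R^δ > log R/600`, so the exponent of the best scales cannot decay faster than
`δ(R) ≥ (log log R − log 600)/log R` — the everywhere-version of the `P`-unit / 2-adic obstruction
(Granville–Tucker at SOME scales).  Same triples `(5^e, 9^i − 5^e, 9^i)`, `2^{k+2} ∣ b` (2-adic discrete
logarithm `exists_pow_five_of_four_dvd`), no definitions. [cite: GranvilleTucker2002, p. 1227]
-/

set_option linter.dupNamespace false

namespace Summit.ABC.ABC.Theorems.Target.Negative

open Literature.NumberTheory.DiophantineGeometry UniqueFactorizationMonoid Finset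

/-- **`G(R) > R log R / 600` at every large scale.** For every `R ≥ 9^{2^{10}}` there is an abc triple with
`rad(abc) ≤ R` and `R · log R < 600 · c`. [cite: GranvilleTucker2002, p. 1227] -/
theorem exists_triple_log_excess :
    ∃ N : ℕ, ∀ R : ℕ, N ≤ R → ∃ a b c : ℕ, IsABCTriple a b c ∧ rad a b c ≤ R ∧
      (R : ℝ) * Real.log R < 600 * c := by
  refine ⟨9 ^ (2 ^ 10), fun R hR => ?_⟩
  have hR0 : R ≠ 0 := by
    have : 0 < 9 ^ (2 ^ 10) := pow_pos (by norm_num) _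
    omega
  -- `9^m ≤ R < 9^{m+1}`, `2^k ≤ m < 2^{k+1}`, `k ≥ 10`
  set m : ℕ := Nat.log 9 R with hm
  have h9m : 9 ^ m ≤ R := Nat.pow_log_le_self 9 hR0
  have hR9 : R < 9 ^ (m + 1) := Nat.lt_pow_succ_log_self (by norm_num) R
  have hm10 : 2 ^ 10 ≤ m := by
    have : 9 ^ (2 ^ 10) < 9 ^ (m + 1) := lt_of_le_of_lt hR hR9
    have := (Nat.pow_lt_pow_iff_right (by norm_num)).mp this
    omega
  have hm0 : m ≠ 0 := by omega
  set k : ℕ := Nat.log 2 m with hk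
  have h2k : 2 ^ k ≤ m := Nat.pow_log_le_self 2 hm0
  have hm2 : m < 2 ^ (k + 1) := Nat.lt_pow_succ_log_self one_lt_two m
  have hk10 : 10 ≤ k := by
    have : 2 ^ 10 < 2 ^ (k + 1) := lt_of_le_of_lt hm10 hm2
    have := (Nat.pow_lt_pow_iff_right (by norm_num)).mp this
    omega
  have h4096 : 4096 ≤ 2 ^ (k + 2) :=
    calc 4096 = 2 ^ 12 := by norm_num
      _ ≤ 2 ^ (k + 2) := Nat.pow_le_pow_right two_pos (by omega)
  -- the least `i` with `270 · 9^i > 2^{k+2} R`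
  have hex : ∃ i : ℕ, 2 ^ (k + 2) * R < 270 * 9 ^ i :=
    ⟨2 ^ (k + 2) * R, lt_of_lt_of_le
      (lt_of_lt_of_le Nat.lt_two_pow_self (Nat.pow_le_pow_left (by norm_num) _))
      (Nat.le_mul_of_pos_left _ (by norm_num))⟩
  classical
  set i : ℕ := Nat.find hex with hidef
  have hi : 2 ^ (k + 2) * R < 270 * 9 ^ i := Nat.find_spec hex
  have hi0 : 0 < i := by
    rw [Nat.pos_iff_ne_zero]
    intro h0
    rw [h0, pow_zero] at hi
    have : R ≤ 2 ^ (k + 2) * R := Nat.le_mul_of_pos_left R (pow_pos two_pos _)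
    have : 9 ^ (2 ^ 10) ≥ 270 := le_trans (by norm_num : 270 ≤ 9 ^ 3) (Nat.pow_le_pow_right (by norm_num) (by norm_num))
    omega
  have hmin : 270 * 9 ^ (i - 1) ≤ 2 ^ (k + 2) * R :=
    not_lt.mp (Nat.find_min hex (show i - 1 < i by omega))
  have him : m + 1 < i := by
    -- `270 · 9^i > 4096 R > 270 · 9 R ≥ 270 · 9^{m+1}`
    have h1 : 270 * 9 ^ (m + 1) ≤ 270 * (9 * R) := by
      rw [pow_succ]; exact Nat.mul_le_mul_left _ (by omega)
    have h2 : 270 * (9 * R) < 2 ^ (k + 2) * R := by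
      have hRpos : 0 < R := Nat.pos_of_ne_zero hR0
      nlinarith
    have h3 : 270 * 9 ^ (m + 1) < 270 * 9 ^ i := lt_trans (lt_of_le_of_lt h1 h2) hi
    exact (Nat.pow_lt_pow_iff_right (by norm_num)).mp (Nat.lt_of_mul_lt_mul_left h3)
  have hik : 2 ^ k < i := by omega
  -- the 2-adic logarithm and the triple `(5^e, 9^i − 5^e, 9^i)`
  have hx4 : (4 : ℤ) ∣ ((9 ^ i : ℕ) : ℤ) - 1 := by
    have h := sub_dvd_pow_sub_pow (9 : ℤ) 1 i
    rw [one_pow] at h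
    push_cast
    exact dvd_trans ⟨2, by norm_num⟩ h
  obtain ⟨e, he, hdvd⟩ := exists_pow_five_of_four_dvd hx4 k
  have halt : 5 ^ e < 9 ^ i :=
    calc 5 ^ e < 5 ^ (2 ^ k) := Nat.pow_lt_pow_right (by norm_num) he
      _ ≤ 9 ^ (2 ^ k) := Nat.pow_le_pow_left (by norm_num) _
      _ < 9 ^ i := Nat.pow_lt_pow_right (by norm_num) hik
  set b : ℕ := 9 ^ i - 5 ^ e with hb
  have hb0 : 0 < b := by rw [hb]; omega
  have hbdvd : 2 ^ (k + 2) ∣ b := by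
    have h1 : ((b : ℕ) : ℤ) = ((9 ^ i : ℕ) : ℤ) - 5 ^ e := by
      rw [hb, Nat.cast_sub halt.le]; push_cast; ring
    have h2 : ((2 ^ (k + 2) : ℕ) : ℤ) ∣ (b : ℤ) := by rw [h1]; exact_mod_cast hdvd
    exact Int.natCast_dvd_natCast.mp h2
  have habc : IsABCTriple (5 ^ e) b (9 ^ i) := by
    refine ⟨pow_pos (by norm_num) e, hb0, by rw [hb]; omega, ?_⟩
    have hcop : Nat.Coprime (5 ^ e) (9 ^ i) := Nat.Coprime.pow e i (by norm_num)
    rw [hb]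
    exact (Nat.coprime_sub_self_right halt.le).mpr hcop
  refine ⟨5 ^ e, b, 9 ^ i, habc, ?_, ?_⟩
  · -- `rad ≤ R`
    have h1 : rad (5 ^ e) b (9 ^ i) * 2 ^ (k + 2) ≤ 30 * b := by
      rw [rad_def]; exact radical_triple_le hb0 hbdvd
    have h2 : b < 9 ^ i := by
      rw [hb]; exact Nat.sub_lt (pow_pos (by norm_num) i) (pow_pos (by norm_num) e)
    have h3 : 9 ^ i = 9 * 9 ^ (i - 1) := by
      rw [← pow_succ']; congr 1; omega
    have h4 : rad (5 ^ e) b (9 ^ i) * 2 ^ (k + 2) < R * 2 ^ (k + 2) := by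
      calc rad (5 ^ e) b (9 ^ i) * 2 ^ (k + 2) ≤ 30 * b := h1
        _ < 30 * 9 ^ i := Nat.mul_lt_mul_of_pos_left h2 (by norm_num)
        _ = 270 * 9 ^ (i - 1) := by rw [h3]; ring
        _ ≤ 2 ^ (k + 2) * R := hmin
        _ = R * 2 ^ (k + 2) := by ring
    exact (Nat.lt_of_mul_lt_mul_right h4).le
  · -- `R log R < 600 c`: `log R < (m+1) log 9 ≤ 2 m log 9`, `2 m R < 2^{k+2} R < 270 · 9^i`
    have hRpos : (0 : ℝ) < R := by exact_mod_cast Nat.pos_of_ne_zero hR0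
    have hlogR : Real.log R < (m + 1) * Real.log 9 := by
      have h1 : (R : ℝ) < (9 : ℝ) ^ (m + 1) := by exact_mod_cast hR9
      have h2 := Real.log_lt_log hRpos h1
      rw [Real.log_pow] at h2
      push_cast at h2
      exact h2
    have hlog9 : Real.log 9 < 2.2 := by
      have h : Real.log 9 = 2 * Real.log 3 := by
        rw [show (9 : ℝ) = 3 ^ 2 by norm_num, Real.log_pow]; push_cast; ring
      rw [h]
      have := Real.log_three_lt_d9
      linarith
    have hlog9pos : 0 < Real.log 9 := Real.log_pos (by norm_num)
    have hm1 : (1 : ℝ) ≤ m := by exact_mod_cast Nat.one_le_iff_ne_zero.mpr hm0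
    have h2mR : 2 * (m : ℝ) * R < 270 * ((9 ^ i : ℕ) : ℝ) := by
      have h1 : 2 * m < 2 ^ (k + 2) := by rw [pow_succ]; omega
      have h2 : 2 * m * R < 270 * 9 ^ i :=
        lt_of_le_of_lt (Nat.mul_le_mul_right R h1.le) hi
      exact_mod_cast h2
    push_cast at h2mR ⊢
    calc (R : ℝ) * Real.log R < R * ((m + 1) * Real.log 9) := mul_lt_mul_of_pos_left hlogR hRpos
      _ ≤ R * (2 * m * Real.log 9) := by
          apply mul_le_mul_of_nonneg_left _ hRpos.le
          exact mul_le_mul_of_nonneg_right (by linarith) hlog9pos.le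
      _ = Real.log 9 * (2 * m * R) := by ring
      _ ≤ 2.2 * (2 * m * R) := mul_le_mul_of_nonneg_right hlog9.le (by positivity)
      _ < 2.2 * (270 * (9 : ℝ) ^ i) := mul_lt_mul_of_pos_left h2mR (by norm_num)
      _ ≤ 600 * (9 : ℝ) ^ i := by nlinarith [pow_pos (by norm_num : (0:ℝ) < 9) i]

end Summit.ABC.ABC.Theorems.Target.Negative
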